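import Mathlib.Analysis.InnerProductSpace.PiL2
import Mathlib.Analysis.Calculus.Deriv.Basic
import Mathlib.Analysis.Calculus.LineDeriv.Basic
import HarnessLib

/-!
# Stub N3 `stub_fderiv_apply_eq_of_invariant` for crux `MoebiusLimitExists`
(stmt-CriticalPhenomena-1344), line `Sketch` v20
(lead prover-line-stmt-CriticalPhenomena-1344-c20-0; THEOREM-ONLY, `--supports stmt-CriticalPhenomena-1344`)

**First-order equivariance of the derivative.**  For `D : (ℝ³)ⁿ → ℝ` differentiable at `x₀` and a
continuous linear map `T` of the displacement space with `D (x₀ + δ) = D (x₀ + T δ)` for every displacement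
`δ`, the covector `fderiv ℝ D x₀` is `T`-invariant: `fderiv ℝ D x₀ δ = fderiv ℝ D x₀ (T δ)` for all `δ`.

Proof: restrict to the line `t ↦ x₀ + t • δ`.  By linearity of `T` (`map_smul`) and the hypothesis, the two
one-variable functions `t ↦ D (x₀ + t • δ)` and `t ↦ D (x₀ + t • T δ)` coincide; by the chain rule
(`HasFDerivAt.hasLineDerivAt`) they have derivatives `fderiv ℝ D x₀ δ` and `fderiv ℝ D x₀ (T δ)` at `t = 0`,
and one-variable derivatives are unique (`HasDerivAt.unique`).  Pure calculus, Mathlib only; no definitions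
are introduced.
-/

noncomputable section

namespace Summit.CriticalPhenomena.Ising3DConformalLimit.MoebiusLimitExistsSketchV20

/-- **Stub N3 — first-order equivariance: a `T`-invariant function has a `T`-invariant derivative.**  For
`D : (ℝ³)ⁿ → ℝ` differentiable at `x₀` and a continuous linear map `T` with `D (x₀ + δ) = D (x₀ + T δ)` for
all displacements `δ`, one has `fderiv ℝ D x₀ δ = fderiv ℝ D x₀ (T δ)` for every `δ`: the restrictions of `D`
to the lines `t ↦ x₀ + t • δ` and `t ↦ x₀ + t • T δ` are the same function of `t` (linearity of `T`), their
derivatives at `0` are `fderiv ℝ D x₀ δ` and `fderiv ℝ D x₀ (T δ)` by the chain rule, and derivatives are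
unique. [folklore] -/
theorem stub_fderiv_apply_eq_of_invariant : ∀ (n : ℕ) (D : (Fin n → EuclideanSpace ℝ (Fin 3)) → ℝ)
    (x₀ : Fin n → EuclideanSpace ℝ (Fin 3))
    (T : (Fin n → EuclideanSpace ℝ (Fin 3)) →L[ℝ] (Fin n → EuclideanSpace ℝ (Fin 3))),
    DifferentiableAt ℝ D x₀ → (∀ δ, D (x₀ + δ) = D (x₀ + T δ)) →
    ∀ δ, fderiv ℝ D x₀ δ = fderiv ℝ D x₀ (T δ) := by
  intro n D x₀ T hD hinv δ
  have h₁ : HasDerivAt (fun t : ℝ => D (x₀ + t • δ)) (fderiv ℝ D x₀ δ) 0 :=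
    hD.hasFDerivAt.hasLineDerivAt δ
  have h₂ : HasDerivAt (fun t : ℝ => D (x₀ + t • T δ)) (fderiv ℝ D x₀ (T δ)) 0 :=
    hD.hasFDerivAt.hasLineDerivAt (T δ)
  have heq : (fun t : ℝ => D (x₀ + t • δ)) = fun t : ℝ => D (x₀ + t • T δ) := by
    funext t
    rw [hinv (t • δ), map_smul]
  rw [heq] at h₁
  exact h₁.unique h₂

end Summit.CriticalPhenomena.Ising3DConformalLimit.MoebiusLimitExistsSketchV20

end
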